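import Literature.AlgebraicGeometry.Modules.CechOrderedResolution
import Literature.AlgebraicGeometry.Modules.DerivedPushforwardAcyclicResolution
import Literature.AlgebraicGeometry.Modules.DerivedPushforwardAmplitude
import Literature.Algebra.Homology.TotalQuasiIsoOfBoundedColumns
import Mathlib.Algebra.Homology.TotalComplex
import HarnessLib

/-!
# The ordered Čech bicomplex of a complex of `𝒪_X`-modules and the quasi-isomorphism
# `I• ⥲ Tot Č•_ord(𝓤, I•)` (Görtz–Wedhorn II (21.19), Lemma 21.75; Hartshorne III Lemma 4.2; Stacks 01FP, 0FLH)

For a scheme `X`, a finite linearly ordered open cover `𝓤 = (U_i)_{i ∈ ι}` (`hcov : ⨆ i, U i = ⊤`) and a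
cochain complex `I•` of `𝒪_X`-modules, the ordered sheaf Čech complexes `Č•_ord(𝓤, Iᵠ)` of the terms
(`Modules/CechOrderedComplex`, `Modules/CechOrderedResolution`: `0 → Iᵠ → Č⁰_ord(𝓤, Iᵠ) → Č¹_ord(𝓤, Iᵠ) → ⋯` is
exact) assemble, by functoriality in the sheaf, into a first-quadrant bicomplex whose total complex receives a
quasi-isomorphism from `I•` (Görtz–Wedhorn II (21.19) / Lemma 21.75: the Čech complex of a complex and
`𝓕 → Tot(Č(𝓤, 𝓕))`; this is the «row resolution» half of the Čech computation of `D⁺_qc`):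

* §1 functoriality of the ordered Čech complex in the sheaf: `CechOrd.faceMap_naturality`, `CechOrd.d_naturality`,
  `CechOrd.augment_naturality`, the chain map `CechOrd.complexMap U φ : Č•_ord(𝓤, M) → Č•_ord(𝓤, N)` and the
  functor **`CechOrd.complexFunctor U : Mod(𝒪_X) ⥤ C⁺(Mod(𝒪_X), ℕ)`** (additive), `CechOrd.augmentι_naturality`;
* §2 the columns functor `CechOrd.columnFunctor U = complexFunctor U ⋙ extend` (the ordered Čech complex as a
  `ℤ`-complex in degrees `≥ 0`), the natural augmentation **`CechOrd.augmentNatTrans U hcov : (–)[0] ⟶ Č•_ord(𝓤, –)`**,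
  a quasi-isomorphism at every module (`quasiIso_augmentNatTrans_app`, from `CechOrderedResolution.exactAugmentation`);
* §3 **`CechOrd.bicomplex U I`** — the bicomplex `(q, p) ↦ Čᵖ_ord(𝓤, Iᵠ)` (outer index the degree `q` of `I•`,
  inner index the Čech degree `p ≥ 0`; vertical maps `Čᵖ(dᵠ)`, horizontal maps the Čech differentials),
  `CechOrd.singleBicomplex I` (`I•` with each term in Čech degree `0`) and the augmentation
  **`CechOrd.bicomplexAugment U I hcov : singleBicomplex I ⟶ bicomplex U I`**, column-wise the augmentations of §2;
  hence **`quasiIso_total_map_bicomplexAugment`**: `Tot` of it is a quasi-isomorphism for `I•` bounded below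
  (column-wise quasi-isomorphisms of first-quadrant bicomplexes,
  `Algebra/Homology/TotalQuasiIsoOfBoundedColumns.quasiIso_total_map_of_quasiIso_columns_of_isStrictlyGE`);
* §4 **`CechOrd.ιTotalSingle I : I• ⟶ Tot(singleBicomplex I)`**, an isomorphism (`isIso_ιTotalSingle`), and the
  composite quasi-isomorphism **`CechOrd.toTotal U I hcov : I• ⟶ Tot Č•_ord(𝓤, I•)`** (`quasiIso_toTotal`).

Everything is PROVED; 0 named facts; no instances (additivity of the functors is stated as theorems and bound
inside the definitions). Not here: any statement about the TERMS of `Tot Č•_ord(𝓤, I•)` beyond their definition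
(they are finite coproducts of the Čech sheaves `Čᵖ_ord(𝓤, Iᵠ)`), nor the replacement of `I•|_{U_s}` by
quasi-coherent models (Stage I (b) of the `D⁺_qc` comparison, cell `pub-hodge-ring2` — a research route conditional
on HC_CM, not a corollary; nothing in this file refers to it).

## References

* U. Görtz, T. Wedhorn, *Algebraic Geometry II: Cohomology of Schemes*, Springer Spektrum (2023): (21.19) and
  Lemma 21.75 (Čech complex of a complex, pp. 262–264), Def. 21.68, Prop. 21.69 (p. 260), Thm. 22.9 (p. 332).
  [GortzWedhorn2023]
* R. Hartshorne, *Algebraic Geometry*, GTM 52 (1977), III Lemma 4.2 and Thm. 4.5 (pp. 220–222). [Hartshorne1977]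
* The Stacks Project, Tags 01FP (Čech complex of a complex of presheaves), 0FLH, 012Z (total complex).
  [StacksProject]
* C. A. Weibel, *An introduction to homological algebra* (1994), 1.2.6, 5.6 (double complexes). [Weibel1994]
-/

noncomputable section

-- `TopCat.Presheaf`/`Scheme.Modules` are not reducible (as in Mathlib's `AlgebraicGeometry/Modules/Sheaf.lean`).
set_option backward.isDefEq.respectTransparency false

universe u

open CategoryTheory CategoryTheory.Limits Opposite TopologicalSpace AlgebraicGeometry HomologicalComplex

namespace Literature.AlgebraicGeometry.Modules

/-- `Čⁿ(φ + ψ) = Čⁿ(φ) + Čⁿ(ψ)` (the Čech sheaves are additive in the sheaf, componentwise).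
[cite: GortzWedhorn2023, (21.19) (p. 262)] -/
theorem Cech.map_add {X : Scheme.{u}} {κ : Type u} (U : κ → X.Opens) (n : ℕ) {M N : X.Modules} (φ ψ : M ⟶ N) :
    Cech.map U n M (φ + ψ) = Cech.map U n M φ + Cech.map U n M ψ :=
  Cech.hom_ext_to fun V s α => by
    rw [Cech.add_app_apply, Cech.map_app_apply, Cech.map_app_apply, Cech.map_app_apply,
      Scheme.Modules.Hom.add_app]
    rfl

namespace CechOrd

open Literature.Algebra.Homology

variable {X : Scheme.{u}} {ι : Type u} [LinearOrder ι] (U : ι → X.Opens) {M N P : X.Modules}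

/-! ## §1 Functoriality of the ordered Čech complex in the sheaf -/

section Functoriality

variable (n : ℕ)

/-- **The face maps are natural in the sheaf**: `∂_a ∘ Čⁿ(φ) = Čⁿ⁺¹(φ) ∘ ∂_a`.
[cite: GortzWedhorn2023, Def. 21.68 (p. 260)] [cite: StacksProject, Tag 01FP] -/
theorem faceMap_naturality (φ : M ⟶ N) (a : ι) :
    faceMap U M n a ≫ Cech.map (faces U (n + 1)) 0 M φ = Cech.map (faces U n) 0 M φ ≫ faceMap U N n a := by
  refine Cech.hom_ext_to fun V c β => ?_
  change φ.app _ (faceFun U M n a V c β) =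
    faceFun U N n a V ((Cech.map (faces U n) 0 M φ).app V c : Cech.Sections (faces U n) 0 N V) β
  by_cases h : a ∈ (β 0).1
  · rw [faceFun_apply_of_mem _ _ _ _ _ _ _ h, faceFun_apply_of_mem _ _ _ _ _ _ _ h, map_zsmul,
      Cech.app_res, Cech.map_app_apply]
  · rw [faceFun_apply_of_not_mem _ _ _ _ _ _ _ h, faceFun_apply_of_not_mem _ _ _ _ _ _ _ h, map_zero]

/-- **The augmentation is natural in the sheaf**: `Č⁰(φ) ∘ ε_M = ε_N ∘ φ`.
[cite: Hartshorne1977, III Lemma 4.2 (p. 220)] -/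
theorem augment_naturality (φ : M ⟶ N) :
    φ ≫ augment U N = augment U M ≫ Cech.map (faces U 0) 0 M φ := by
  refine Cech.hom_ext_to fun V x β => ?_
  change Cech.res N _ (φ.app V x) = φ.app _ (Cech.res M _ x)
  rw [Cech.app_res]

variable [Fintype ι]

/-- **The ordered Čech differential is natural in the sheaf**: `d ∘ Čⁿ(φ) = Čⁿ⁺¹(φ) ∘ d`.
[cite: GortzWedhorn2023, Def. 21.68 (p. 260)] [cite: StacksProject, Tag 01FP] -/
theorem d_naturality (φ : M ⟶ N) :
    d U M n ≫ Cech.map (faces U (n + 1)) 0 M φ = Cech.map (faces U n) 0 M φ ≫ d U N n := by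
  simp only [d, Preadditive.sum_comp, Preadditive.comp_sum, faceMap_naturality]

/-- **`Č•_ord(𝓤, φ)`**: the chain map of ordered Čech complexes induced by `φ : M → N` (componentwise `Čⁿ(φ)`).
[cite: GortzWedhorn2023, (21.19) (p. 262)] [cite: StacksProject, Tag 01FP] -/
def complexMap (φ : M ⟶ N) : complex U M ⟶ complex U N :=
  CochainComplex.ofHom (fun n => Cech.map (faces U n) 0 M φ) fun n => by
    rw [complex_d, complex_d]
    exact (d_naturality U n φ).symm

/-- Components of `Č•_ord(𝓤, φ)`. [cite: GortzWedhorn2023, (21.19) (p. 262)] -/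
@[simp]
theorem complexMap_f (φ : M ⟶ N) : (complexMap U φ).f n = Cech.map (faces U n) 0 M φ := rfl

/-- `Č•_ord(𝓤, 𝟙) = 𝟙`. [cite: GortzWedhorn2023, (21.19) (p. 262)] -/
@[simp]
theorem complexMap_id : complexMap U (𝟙 M) = 𝟙 _ := by
  ext n : 1
  rw [complexMap_f, Cech.map_id]
  rfl

/-- `Č•_ord(𝓤, φ ≫ ψ) = Č•_ord(𝓤, φ) ≫ Č•_ord(𝓤, ψ)`. [cite: GortzWedhorn2023, (21.19) (p. 262)] -/
theorem complexMap_comp (φ : M ⟶ N) (ψ : N ⟶ P) :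
    complexMap U (φ ≫ ψ) = complexMap U φ ≫ complexMap U ψ := by
  ext n : 1
  rw [complexMap_f, Cech.map_comp]
  rfl

variable (X) in
/-- **The ordered Čech complex as a functor `Mod(𝒪_X) ⥤ C(Mod(𝒪_X), ℕ)`**, `M ↦ Č•_ord(𝓤, M)`.
[cite: GortzWedhorn2023, (21.19) (p. 262)] [cite: StacksProject, Tag 01FP] -/
def complexFunctor : X.Modules ⥤ CochainComplex X.Modules ℕ where
  obj M := complex U M
  map φ := complexMap U φ
  map_id _ := complexMap_id U
  map_comp φ ψ := complexMap_comp U φ ψ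

/-- `complexFunctor` on objects (definitional). [cite: GortzWedhorn2023, (21.19) (p. 262)] -/
theorem complexFunctor_obj (M : X.Modules) : (complexFunctor X U).obj M = complex U M := rfl

/-- `complexFunctor` on morphisms (definitional). [cite: GortzWedhorn2023, (21.19) (p. 262)] -/
theorem complexFunctor_map (φ : M ⟶ N) : (complexFunctor X U).map φ = complexMap U φ := rfl

/-- `M ↦ Č•_ord(𝓤, M)` is additive. [cite: GortzWedhorn2023, (21.19) (p. 262)] -/
theorem additive_complexFunctor : (complexFunctor X U).Additive :=
  ⟨fun {M N φ ψ} => by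
    ext n : 1
    change (complexMap U (φ + ψ)).f n = (complexMap U φ).f n + (complexMap U ψ).f n
    rw [complexMap_f, complexMap_f, complexMap_f, Cech.map_add]⟩

end Functoriality

/-! ## §2 The columns: the ordered Čech complex as a bounded-below `ℤ`-complex, and the natural augmentation -/

section Columns

variable [Fintype ι]

variable (X) in
/-- **The column functor** `M ↦ Č•_ord(𝓤, M)` viewed as a cochain complex indexed by `ℤ` (zero in negative
degrees; Mathlib `extend` along `embeddingUpNat`). [cite: GortzWedhorn2023, (21.19) (p. 262)] -/
def columnFunctor : X.Modules ⥤ CochainComplex X.Modules ℤ :=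
  complexFunctor X U ⋙ ComplexShape.embeddingUpNat.extendFunctor X.Modules

/-- `columnFunctor` on objects (definitional). [cite: GortzWedhorn2023, (21.19) (p. 262)] -/
theorem columnFunctor_obj (M : X.Modules) :
    (columnFunctor X U).obj M = (complex U M).extend ComplexShape.embeddingUpNat := rfl

/-- `columnFunctor` on morphisms (definitional). [cite: GortzWedhorn2023, (21.19) (p. 262)] -/
theorem columnFunctor_map (φ : M ⟶ N) :
    (columnFunctor X U).map φ = extendMap (complexMap U φ) ComplexShape.embeddingUpNat := rfl

/-- The column functor is additive. [cite: GortzWedhorn2023, (21.19) (p. 262)] -/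
theorem additive_columnFunctor : (columnFunctor X U).Additive :=
  haveI := additive_complexFunctor U
  inferInstanceAs (complexFunctor X U ⋙ ComplexShape.embeddingUpNat.extendFunctor X.Modules).Additive

/-- The columns are concentrated in degrees `≥ 0`. [cite: GortzWedhorn2023, (21.19) (p. 262)] -/
theorem isStrictlyGE_columnFunctor_obj (M : X.Modules) : CochainComplex.IsStrictlyGE ((columnFunctor X U).obj M) 0 :=
  inferInstanceAs (CochainComplex.IsStrictlyGE ((complex U M).extend ComplexShape.embeddingUpNat) 0)

/-- Degree `0` of `plusOfNatι ι` for an augmentation `ι : N[0] ⟶ K•` of an `ℕ`-complex: `N ≅ N[0]⁰ → K⁰ ≅ (extend K)⁰`.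
[cite: Hartshorne1977, III §1 p. 204 (resolutions)] -/
theorem plusOfNatι_hom_f_zero {N : X.Modules} {K : CochainComplex X.Modules ℕ}
    (ι' : (CochainComplex.single₀ X.Modules).obj N ⟶ K) :
    (plusOfNatι ι').hom.f 0 = (singleObjXSelf (ComplexShape.up ℤ) 0 N).hom ≫ ι'.f 0 ≫
      (K.extendXIso ComplexShape.embeddingUpNat (i := 0) (by simp)).inv := by
  change ((extendSingleIso _ _ _ _ _).inv ≫ extendMap ι' _).f 0 = _
  rw [comp_f, extendSingleIso_inv_f, extendMap_f ι' ComplexShape.embeddingUpNat (i := 0) (by simp)]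
  simp [CochainComplex.single₀ObjXSelf]

variable (hcov : ⨆ i, U i = ⊤)

/-- **The natural augmentation `M[0] ⟶ Č•_ord(𝓤, M)`** of bounded-below `ℤ`-complexes (the morphism
`plusOfNatι` of the ordered Čech resolution `CechOrderedResolution.exactAugmentation`, natural in `M`).
[cite: Hartshorne1977, III Lemma 4.2 (p. 220)] [cite: GortzWedhorn2023, Prop. 21.69 (p. 260)] -/
def augmentNatTrans : HomologicalComplex.single X.Modules (ComplexShape.up ℤ) 0 ⟶ columnFunctor X U where
  app M := (plusOfNatι (exactAugmentation U M hcov).augmentι).hom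
  naturality {M N} φ := by
    apply from_single_hom_ext
    rw [comp_f, comp_f, single_map_f_self, plusOfNatι_hom_f_zero, plusOfNatι_hom_f_zero,
      ExactAugmentation.augmentι_f_zero, ExactAugmentation.augmentι_f_zero, exactAugmentation_ε,
      exactAugmentation_ε, columnFunctor_map, extendMap_f _ ComplexShape.embeddingUpNat (i := 0) (by simp),
      complexMap_f]
    simp only [Category.assoc, Iso.inv_hom_id_assoc]
    rw [reassoc_of% (augment_naturality U φ)]

/-- The component of the augmentation at `M` is `plusOfNatι` of the ordered Čech resolution of `M`.
[cite: Hartshorne1977, III Lemma 4.2 (p. 220)] -/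
theorem augmentNatTrans_app (M : X.Modules) :
    (augmentNatTrans U hcov).app M = (plusOfNatι (exactAugmentation U M hcov).augmentι).hom := rfl

/-- **The augmentation `M[0] ⟶ Č•_ord(𝓤, M)` is a quasi-isomorphism** (the ordered Čech resolution is exact).
[cite: GortzWedhorn2023, Prop. 21.69 (p. 260) and Thm. 22.9 (p. 332)] [cite: Hartshorne1977, III Lemma 4.2 (p. 220)] -/
theorem quasiIso_augmentNatTrans_app (M : X.Modules) : QuasiIso ((augmentNatTrans U hcov).app M) := by
  haveI := (exactAugmentation U M hcov).quasiIso_augmentι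
  exact quasiIso_plusOfNatι_hom _

end Columns

/-! ## §3 The ordered Čech bicomplex of a complex and its augmentation -/

section Bicomplex

variable [Fintype ι] (I : CochainComplex X.Modules ℤ)

/-- **The ordered Čech bicomplex `Č•_ord(𝓤, I•)` of a cochain complex of `𝒪_X`-modules**: outer index the
degree `q` of `I•`, column `q` the ordered Čech complex `Č•_ord(𝓤, Iᵠ)` (in degrees `≥ 0`), maps between columns
`Č•(dᵠ)`. [cite: GortzWedhorn2023, (21.19) and Lemma 21.75 (pp. 262–264)] [cite: StacksProject, Tag 01FP] -/
def bicomplex : HomologicalComplex₂ X.Modules (ComplexShape.up ℤ) (ComplexShape.up ℤ) :=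
  haveI := additive_columnFunctor (X := X) U
  ((columnFunctor X U).mapHomologicalComplex (ComplexShape.up ℤ)).obj I

/-- The columns of the Čech bicomplex (definitional). [cite: GortzWedhorn2023, (21.19) (p. 262)] -/
theorem bicomplex_X (q : ℤ) : (bicomplex U I).X q = (complex U (I.X q)).extend ComplexShape.embeddingUpNat := rfl

/-- The maps between the columns of the Čech bicomplex (definitional). [cite: GortzWedhorn2023, (21.19) (p. 262)] -/
theorem bicomplex_d (q q' : ℤ) :
    (bicomplex U I).d q q' = extendMap (complexMap U (I.d q q')) ComplexShape.embeddingUpNat := rfl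

/-- The entries of the Čech bicomplex in non-negative Čech degree: `Čᵖ_ord(𝓤, Iᵠ)`.
[cite: GortzWedhorn2023, (21.19) (p. 262)] -/
def bicomplexXXIso (q : ℤ) (p : ℕ) : ((bicomplex U I).X q).X (p : ℤ) ≅ obj U (I.X q) p :=
  (complex U (I.X q)).extendXIso ComplexShape.embeddingUpNat (i := p) rfl

/-- The entries of the Čech bicomplex in negative Čech degree vanish. [cite: GortzWedhorn2023, (21.19) (p. 262)] -/
theorem isZero_bicomplex_X_X (q p : ℤ) (hp : p < 0) : IsZero (((bicomplex U I).X q).X p) :=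
  isZero_extend_X _ _ _ fun i (hi : ((i : ℕ) : ℤ) = p) => by omega

/-- **`I•` as a bicomplex concentrated in Čech degree `0`** (outer index `q`, column `q` the complex `Iᵠ[0]`).
[cite: Weibel1994, 1.2.6] -/
def singleBicomplex : HomologicalComplex₂ X.Modules (ComplexShape.up ℤ) (ComplexShape.up ℤ) :=
  ((HomologicalComplex.single X.Modules (ComplexShape.up ℤ) 0).mapHomologicalComplex (ComplexShape.up ℤ)).obj I

/-- The columns of `singleBicomplex I` (definitional). [cite: Weibel1994, 1.2.6] -/
theorem singleBicomplex_X (q : ℤ) :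
    (singleBicomplex I).X q = (HomologicalComplex.single X.Modules (ComplexShape.up ℤ) 0).obj (I.X q) := rfl

variable (hcov : ⨆ i, U i = ⊤)

/-- **The augmentation `I•[0] ⟶ Č•_ord(𝓤, I•)` of bicomplexes** (column `q`: `Iᵠ[0] ⟶ Č•_ord(𝓤, Iᵠ)`).
[cite: GortzWedhorn2023, Lemma 21.75 (p. 264)] [cite: Hartshorne1977, III Lemma 4.2 (p. 220)] -/
def bicomplexAugment : singleBicomplex I ⟶ bicomplex U I :=
  haveI := additive_columnFunctor (X := X) U
  (NatTrans.mapHomologicalComplex (augmentNatTrans U hcov) (ComplexShape.up ℤ)).app I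

/-- The columns of the augmentation are the augmentations of the terms. [cite: GortzWedhorn2023, Lemma 21.75 (p. 264)] -/
theorem bicomplexAugment_f (q : ℤ) : (bicomplexAugment U I hcov).f q = (augmentNatTrans U hcov).app (I.X q) := rfl

/-- The Čech bicomplex of a complex in degrees `≥ a` has columns `≥ a`. [cite: GortzWedhorn2023, (21.19) (p. 262)] -/
theorem isStrictlyGE_bicomplex (a : ℤ) [I.IsStrictlyGE a] : CochainComplex.IsStrictlyGE (bicomplex U I) a := by
  haveI := additive_columnFunctor (X := X) U
  rw [CochainComplex.isStrictlyGE_iff]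
  intro q hq
  exact Functor.map_isZero (columnFunctor X U) (I.isZero_of_isStrictlyGE a q hq)

/-- `singleBicomplex I` has columns `≥ a` when `I•` is in degrees `≥ a`. [cite: Weibel1994, 1.2.6] -/
theorem isStrictlyGE_singleBicomplex (a : ℤ) [I.IsStrictlyGE a] :
    CochainComplex.IsStrictlyGE (singleBicomplex I) a := by
  rw [CochainComplex.isStrictlyGE_iff]
  intro q hq
  exact Functor.map_isZero (HomologicalComplex.single X.Modules (ComplexShape.up ℤ) 0) (I.isZero_of_isStrictlyGE a q hq)

/-- **`Tot(I•[0]) ⟶ Tot Č•_ord(𝓤, I•)` is a quasi-isomorphism** for a bounded-below complex `I•`: column-wise it is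
the augmentation `Iᵠ[0] ⥲ Č•_ord(𝓤, Iᵠ)` of the exact ordered Čech resolution, and a column-wise quasi-isomorphism
of first-quadrant bicomplexes induces a quasi-isomorphism of total complexes
(`Algebra/Homology/TotalQuasiIsoOfBoundedColumns`). [cite: GortzWedhorn2023, Lemma 21.75 (p. 264)]
[cite: Hartshorne1977, III Lemma 4.2 and Thm. 4.5 (pp. 220–222)] [cite: StacksProject, Tag 0FLH] -/
theorem quasiIso_total_map_bicomplexAugment (a : ℤ) [I.IsStrictlyGE a] :
    QuasiIso (HomologicalComplex₂.total.map (bicomplexAugment U I hcov) (ComplexShape.up ℤ)) := by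
  haveI := isStrictlyGE_bicomplex U I a
  haveI := isStrictlyGE_singleBicomplex I a
  exact Literature.Algebra.Homology.quasiIso_total_map_of_quasiIso_columns_of_isStrictlyGE
    (singleBicomplex I) (bicomplex U I) (bicomplexAugment U I hcov) a 0
    (fun q => inferInstanceAs
      (CochainComplex.IsStrictlyGE ((HomologicalComplex.single X.Modules (ComplexShape.up ℤ) 0).obj (I.X q)) 0))
    (fun q => isStrictlyGE_columnFunctor_obj U (I.X q))
    (fun q => quasiIso_augmentNatTrans_app U hcov (I.X q))

end Bicomplex

/-! ## §4 `I• ≅ Tot(I•[0])` and the quasi-isomorphism `I• ⥲ Tot Č•_ord(𝓤, I•)` -/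

section Total

variable [Fintype ι] (I : CochainComplex X.Modules ℤ)

/-- The comparison maps `Iⁿ ≅ I•[0]^{n,0} ⟶ Tot(I•[0])ⁿ`. [cite: Weibel1994, 1.2.6 and Ex. 1.2.8] -/
def ιTotalSingleF (n : ℤ) : I.X n ⟶ ((singleBicomplex I).total (ComplexShape.up ℤ)).X n :=
  (singleObjXSelf (ComplexShape.up ℤ) 0 (I.X n)).inv ≫
    (singleBicomplex I).ιTotal (ComplexShape.up ℤ) n 0 n (add_zero n)

/-- The comparison maps are isomorphisms (all other summands of `Tot(I•[0])ⁿ` vanish).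
[cite: Weibel1994, 1.2.6 and Ex. 1.2.8] -/
theorem isIso_ιTotalSingleF (n : ℤ) : IsIso (ιTotalSingleF I n) := by
  haveI : IsIso ((singleBicomplex I).ιTotal (ComplexShape.up ℤ) n 0 n (add_zero n)) :=
    Literature.Algebra.Homology.isIso_ιTotal_of_isZero _ n 0 n (add_zero n)
      fun j₁ j₂ hj hj₁ => isZero_single_obj_X (ComplexShape.up ℤ) 0 (I.X j₁) j₂ (by omega)
  unfold ιTotalSingleF
  infer_instance

/-- **`I• ⟶ Tot(I•[0])`**, the comparison chain map (no sign: `ε₁ = 1`). [cite: Weibel1994, 1.2.6 and Ex. 1.2.8]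
[cite: StacksProject, Tag 012Z] -/
def ιTotalSingle : I ⟶ (singleBicomplex I).total (ComplexShape.up ℤ) where
  f n := ιTotalSingleF I n
  comm' n m hnm := by
    obtain rfl : n + 1 = m := hnm
    dsimp only [ιTotalSingleF]
    rw [Category.assoc, HomologicalComplex₂.total_d, Preadditive.comp_add, HomologicalComplex₂.ι_D₁,
      HomologicalComplex₂.ι_D₂,
      (singleBicomplex I).d₂_eq' (ComplexShape.up ℤ) n (show (ComplexShape.up ℤ).Rel (0 : ℤ) 1 by simp) (n + 1),
      (singleBicomplex I).d₁_eq (ComplexShape.up ℤ) (show (ComplexShape.up ℤ).Rel n (n + 1) by simp) 0 (n + 1)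
        (add_zero _)]
    have h0 : ((singleBicomplex I).X n).d 0 1 = 0 := single_obj_d _ _ _ _ _
    have h1 : ((singleBicomplex I).d n (n + 1)).f 0 = (singleObjXSelf (ComplexShape.up ℤ) 0 (I.X n)).hom ≫
        I.d n (n + 1) ≫ (singleObjXSelf (ComplexShape.up ℤ) 0 (I.X (n + 1))).inv :=
      single_map_f_self _ _ _
    rw [h0, zero_comp, smul_zero, add_zero, h1]
    change _ ≫ ((1 : ℤˣ) • _) = _
    rw [one_smul]
    simp only [Category.assoc, Iso.inv_hom_id_assoc]

/-- `I• ⟶ Tot(I•[0])` is an isomorphism. [cite: Weibel1994, 1.2.6 and Ex. 1.2.8] -/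
theorem isIso_ιTotalSingle : IsIso (ιTotalSingle I) := by
  haveI : ∀ n, IsIso ((ιTotalSingle I).f n) := fun n => isIso_ιTotalSingleF I n
  exact Hom.isIso_of_components _

variable (hcov : ⨆ i, U i = ⊤)

/-- **The Čech augmentation `I• ⟶ Tot Č•_ord(𝓤, I•)`.** [cite: GortzWedhorn2023, Lemma 21.75 (p. 264)]
[cite: Hartshorne1977, III Lemma 4.2 (p. 220)] -/
def toTotal : I ⟶ (bicomplex U I).total (ComplexShape.up ℤ) :=
  ιTotalSingle I ≫ HomologicalComplex₂.total.map (bicomplexAugment U I hcov) (ComplexShape.up ℤ)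

/-- **`I• ⥲ Tot Č•_ord(𝓤, I•)` is a quasi-isomorphism for every bounded-below complex `I•` of `𝒪_X`-modules and
every finite open cover `𝓤`.** [cite: GortzWedhorn2023, Lemma 21.75 (p. 264)] [cite: Hartshorne1977, III Lemma 4.2 and Thm. 4.5 (pp. 220–222)]
[cite: StacksProject, Tag 0FLH] -/
theorem quasiIso_toTotal (a : ℤ) [I.IsStrictlyGE a] : QuasiIso (toTotal U I hcov) := by
  haveI := isIso_ιTotalSingle I
  haveI := quasiIso_total_map_bicomplexAugment U I hcov a
  unfold toTotal
  infer_instance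

end Total

end CechOrd

end Literature.AlgebraicGeometry.Modules

end
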